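import Summits.AnomalousDissipation.AnomalousDissipation.Theorems.StirringSphereEnsembleRealizationStubAugCurrentLevelEnergyGap

/-!
# Crux `EnsembleRealization` (stmt-AnomalousDissipation-0215) — line `augmented-lift`,
# sub-stub (M1a) `stub_augCurrentLevelPairs`, piece (L5)/Energy: the energy link

Supports stmt-AnomalousDissipation-0215 (stub `stub_augCurrentLevelPairs` of line
`augmented-lift`, piece L5 `stub_augCurrentLevelLinkTools`, ENERGY part of step (A6) of
`augCurrent-notes.md` §3). Nothing here closes an item. Theorems only.

ENERGY LINK. Along the levels of `stub_augCurrentLevelPairs` (bases `g n` complete for `P_{N n}`,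
`N n → ∞`, one-sided product mollifiers of width `δ n → 0`, mollified coordinate laws
`p₁ n(z) = ∫ ρ(z − Z u) dμ`, mixing weights `ε n → 0`, `θ n = R/(R + δ n)`, level laws `m n` given
by the transport formula `∫ G d(m n) = (1 − ε) ∫ G p₁ + ε c ∫_{Bx} G`, level currents `J n` with the
CEI bound `J_e + 2 ∫ ρ(z − Z u)(ν‖u‖_V² − (u, f)) dμ ≤ 0` and velocities `V = (1 − ε) J / q`,
`q = (1 − ε) p₁ + ε c`), the positive part of `V_e + 2 S`,
`S(z) = ν · 4π² Σ_{|k| ≤ K} |k|² ‖𝓕(θ Σ zⱼ gⱼ)(k)‖² − (f, θ Σ zⱼ gⱼ)` (truncated dissipation minus work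
of the synthesized field), has `m n`-integral tending to zero. Proof (`level_assembly_le`, an
abstract real-variable assembly on `ℝ^D × ℝ`): on the density part
`(V_e + 2S) p₁ = λ J_e + 2 S p₁ ≤ 2 λ (S p₁ − ∫ κ D) + 2 (1 − λ) S p₁ ≤ 2 η p₁ + 2 M ε c/(1 − ε) 𝟙_{Bx}`
by the kernel gap `S p₁ − ∫ κ D ≤ η p₁` and the box bound `|S| ≤ M` of
`stub_augCurrentLevelEnergyGapTools` / `level_sup_le` (`λ = (1 − ε) p₁/q ∈ [0, 1]`,
`(1 − λ) p₁ ≤ ε c/(1 − ε)`); on the uniform part `max 0 (V_e + 2S) ≤ 2 ‖f‖₂ R + 2 M`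
(`energyCurrent_le`); with `c · vol(Bx) = 1` (`stub_augCurrentLevelTransportTools`) the total is
`≤ 2 η_n + ε_n (2 ‖f‖₂ R + 4 M) → 0` (`η_n → 0` as `δ n → 0`, `N n → ∞`, `‖P_N f − f‖₂ → 0`).
Packaged as `stub_augCurrentLevelEnergyTools`.
-/

noncomputable section

set_option linter.dupNamespace false

open MeasureTheory Set Filter Topology Function Metric UnitAddTorus
open scoped BigOperators ENNReal InnerProductSpace RealInnerProductSpace

namespace Summit.AnomalousDissipation.AnomalousDissipation.Theorems.EnsembleRealization

open Literature.Analysis.FunctionSpaces Literature.Analysis.FunctionSpaces.Torus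
open Literature.Analysis.FluidPDE Literature.Analysis.FluidPDE.Torus

/-! ### The abstract assembly of one level -/

/-- **Abstract assembly of one level.** On `ℝ^D × ℝ` with the box `Bx`, a density `0 ≤ p₁` of unit
mass vanishing off `Bx`, weights `0 < ε < 1`, `c` with `c · vol(Bx) = 1`, currents with
`J_e + 2 I ≤ 0`, `J_e ≤ 2 C p₁`, the kernel gap `(ν A − W) p₁ − I ≤ η p₁`, the box bound `|ν A − W| ≤ M`
and `V = (1 − ε) J / ((1 − ε) p₁ + ε c)`: the transported integral of `max 0 (V_e + 2 ν A − 2 W)` is at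
most `2 η + ε (2 C + 4 M)`. -/
theorem level_assembly_le {D : ℕ} {R δ ε c ν η M C : ℝ} (hε : 0 < ε ∧ ε < 1) (hη : 0 ≤ η) (hM : 0 ≤ M)
    (hC : 0 ≤ C) {p₁ A W I : EuclideanSpace ℝ (Fin D) × ℝ → ℝ}
    {J V : EuclideanSpace ℝ (Fin D) × ℝ → EuclideanSpace ℝ (Fin D) × ℝ} (hp0 : ∀ z, 0 ≤ p₁ z)
    (hpB : ∀ z, z ∉ closedBall (0 : EuclideanSpace ℝ (Fin D)) (R + δ) ×ˢ Icc 0 (R ^ 2 + δ) → p₁ z = 0)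
    (hp1 : ∫ z, p₁ z ∂((volume : Measure (EuclideanSpace ℝ (Fin D))).prod (volume : Measure ℝ)) = 1)
    (hJe : ∀ z, (J z).2 + 2 * I z ≤ 0) (hJC : ∀ z, (J z).2 ≤ 2 * C * p₁ z)
    (hgap : ∀ z, (ν * A z - W z) * p₁ z - I z ≤ η * p₁ z)
    (hsup : ∀ z ∈ closedBall (0 : EuclideanSpace ℝ (Fin D)) (R + δ) ×ˢ Icc 0 (R ^ 2 + δ), |ν * A z - W z| ≤ M)
    (hq : ∀ z, 0 < (1 - ε) * p₁ z + ε * c) (hV : ∀ z, V z = ((1 - ε) / ((1 - ε) * p₁ z + ε * c)) • J z)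
    (hc : c * (((volume : Measure (EuclideanSpace ℝ (Fin D))).prod (volume : Measure ℝ))
      (closedBall (0 : EuclideanSpace ℝ (Fin D)) (R + δ) ×ˢ Icc 0 (R ^ 2 + δ))).toReal = 1)
    {m : Measure (EuclideanSpace ℝ (Fin D) × ℝ)}
    (htr : ∫ z, max 0 ((V z).2 + 2 * (ν * A z) - 2 * W z) ∂m =
      (1 - ε) * ∫ z, max 0 ((V z).2 + 2 * (ν * A z) - 2 * W z) * p₁ z
          ∂((volume : Measure (EuclideanSpace ℝ (Fin D))).prod (volume : Measure ℝ)) +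
        ε * c * ∫ z in closedBall (0 : EuclideanSpace ℝ (Fin D)) (R + δ) ×ˢ Icc 0 (R ^ 2 + δ),
          max 0 ((V z).2 + 2 * (ν * A z) - 2 * W z) ∂((volume : Measure (EuclideanSpace ℝ (Fin D))).prod (volume : Measure ℝ))) :
    ∫ z, max 0 ((V z).2 + 2 * (ν * A z) - 2 * W z) ∂m ≤ 2 * η + ε * (2 * C + 4 * M) := by
  obtain ⟨hε0, hε1⟩ := hε
  set vol : Measure (EuclideanSpace ℝ (Fin D) × ℝ) :=
    (volume : Measure (EuclideanSpace ℝ (Fin D))).prod (volume : Measure ℝ) with hvol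
  set Bx : Set (EuclideanSpace ℝ (Fin D) × ℝ) :=
    closedBall (0 : EuclideanSpace ℝ (Fin D)) (R + δ) ×ˢ Icc 0 (R ^ 2 + δ) with hBx
  have hBxfin : vol Bx < ∞ := ((isCompact_closedBall _ _).prod isCompact_Icc).measure_lt_top
  have hBxm : MeasurableSet Bx := (isClosed_closedBall.prod isClosed_Icc).measurableSet
  have hc0 : 0 < c := by
    by_contra h
    have : c * (vol Bx).toReal ≤ 0 := mul_nonpos_of_nonpos_of_nonneg (not_lt.1 h) ENNReal.toReal_nonneg
    linarith
  have hE0 : 0 ≤ ε * c / (1 - ε) := div_nonneg (mul_nonneg hε0.le hc0.le) (by linarith)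
  -- the density part, pointwise
  have hdens : ∀ z, max 0 ((V z).2 + 2 * (ν * A z) - 2 * W z) * p₁ z ≤
      2 * η * p₁ z + Bx.indicator (fun _ => 2 * M * (ε * c / (1 - ε))) z := by
    intro z
    by_cases hz : z ∈ Bx
    · rw [indicator_of_mem hz]
      have hqz := hq z
      have hVe : (V z).2 = (1 - ε) / ((1 - ε) * p₁ z + ε * c) * (J z).2 := by rw [hV z]; rfl
      have hL0 : 0 ≤ (1 - ε) * p₁ z / ((1 - ε) * p₁ z + ε * c) :=
        div_nonneg (mul_nonneg (by linarith) (hp0 z)) hqz.le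
      have hL1 : (1 - ε) * p₁ z / ((1 - ε) * p₁ z + ε * c) ≤ 1 := by
        rw [div_le_one hqz]; nlinarith [hp0 z]
      have hLp : (1 - (1 - ε) * p₁ z / ((1 - ε) * p₁ z + ε * c)) * p₁ z ≤ ε * c / (1 - ε) := by
        have h1 : 1 - (1 - ε) * p₁ z / ((1 - ε) * p₁ z + ε * c) = ε * c / ((1 - ε) * p₁ z + ε * c) := by
          field_simp; ring
        rw [h1, div_mul_eq_mul_div, div_le_div_iff₀ hqz (by linarith)]
        nlinarith [mul_pos hε0 hc0, hp0 z]
      rw [max_mul_of_nonneg _ _ (hp0 z), zero_mul]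
      refine max_le (add_nonneg (mul_nonneg (mul_nonneg two_pos.le hη) (hp0 z))
        (mul_nonneg (mul_nonneg two_pos.le hM) hE0)) ?_
      have hS := hsup z hz
      have h1 : (1 - ε) * p₁ z / ((1 - ε) * p₁ z + ε * c) * (J z).2 ≤
          (1 - ε) * p₁ z / ((1 - ε) * p₁ z + ε * c) * (-2 * I z) :=
        mul_le_mul_of_nonneg_left (by linarith [hJe z]) hL0
      have h2 : (1 - ε) * p₁ z / ((1 - ε) * p₁ z + ε * c) * ((ν * A z - W z) * p₁ z - I z) ≤
          (1 - ε) * p₁ z / ((1 - ε) * p₁ z + ε * c) * (η * p₁ z) := mul_le_mul_of_nonneg_left (hgap z) hL0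
      have h3 : (1 - (1 - ε) * p₁ z / ((1 - ε) * p₁ z + ε * c)) * ((ν * A z - W z) * p₁ z) ≤
          (1 - (1 - ε) * p₁ z / ((1 - ε) * p₁ z + ε * c)) * p₁ z * M := by
        rw [mul_comm (ν * A z - W z) (p₁ z), ← mul_assoc]
        exact mul_le_mul_of_nonneg_left ((le_abs_self _).trans hS) (mul_nonneg (by linarith) (hp0 z))
      have h4 : (1 - (1 - ε) * p₁ z / ((1 - ε) * p₁ z + ε * c)) * p₁ z * M ≤ ε * c / (1 - ε) * M :=
        mul_le_mul_of_nonneg_right hLp hM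
      have h5 : (1 - ε) * p₁ z / ((1 - ε) * p₁ z + ε * c) * (η * p₁ z) ≤ η * p₁ z :=
        mul_le_of_le_one_left (mul_nonneg hη (hp0 z)) hL1
      have hVp : (V z).2 * p₁ z = (1 - ε) * p₁ z / ((1 - ε) * p₁ z + ε * c) * (J z).2 := by
        rw [hVe]; ring
      nlinarith [h1, h2, h3, h4, h5, hVp]
    · rw [hpB z hz, mul_zero, mul_zero, indicator_of_notMem hz, add_zero]
  -- the uniform part, pointwise on the box
  have hunif : ∀ z ∈ Bx, max 0 ((V z).2 + 2 * (ν * A z) - 2 * W z) ≤ 2 * C + 2 * M := by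
    intro z hz
    have hqz := hq z
    have hVe : (V z).2 = (1 - ε) / ((1 - ε) * p₁ z + ε * c) * (J z).2 := by rw [hV z]; rfl
    have hS := (le_abs_self _).trans (hsup z hz)
    refine max_le (by linarith) ?_
    have h1 : (V z).2 ≤ 2 * C :=
      calc (V z).2 = (1 - ε) / ((1 - ε) * p₁ z + ε * c) * (J z).2 := hVe
        _ ≤ (1 - ε) / ((1 - ε) * p₁ z + ε * c) * (2 * C * p₁ z) :=
            mul_le_mul_of_nonneg_left (hJC z) (div_nonneg (by linarith) hqz.le)
        _ = 2 * C * ((1 - ε) * p₁ z / ((1 - ε) * p₁ z + ε * c)) := by ring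
        _ ≤ 2 * C * 1 := mul_le_mul_of_nonneg_left (by rw [div_le_one hqz]; nlinarith [hp0 z]) (by linarith)
        _ = 2 * C := mul_one _
    linarith
  -- the two integrals
  have hp1i : Integrable p₁ vol := Integrable.of_integral_ne_zero (by rw [hp1]; exact one_ne_zero)
  have hind : Integrable (Bx.indicator fun _ => 2 * M * (ε * c / (1 - ε))) vol :=
    (integrable_indicator_iff hBxm).2 (integrableOn_const hBxfin.ne)
  have hI1 : ∫ z, max 0 ((V z).2 + 2 * (ν * A z) - 2 * W z) * p₁ z ∂vol ≤
      2 * η + 2 * M * (ε * c / (1 - ε)) * (vol Bx).toReal :=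
    calc ∫ z, max 0 ((V z).2 + 2 * (ν * A z) - 2 * W z) * p₁ z ∂vol
        ≤ ∫ z, (2 * η * p₁ z + Bx.indicator (fun _ => 2 * M * (ε * c / (1 - ε))) z) ∂vol :=
          integral_mono_of_nonneg (Eventually.of_forall fun z => mul_nonneg (le_max_left _ _) (hp0 z))
            ((hp1i.const_mul _).add hind) (Eventually.of_forall hdens)
      _ = 2 * η + 2 * M * (ε * c / (1 - ε)) * (vol Bx).toReal := by
          rw [integral_add (hp1i.const_mul _) hind, integral_const_mul, hp1, mul_one,
            integral_indicator_const _ hBxm, smul_eq_mul, measureReal_def]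
          ring
  have hI2 : ∫ z in Bx, max 0 ((V z).2 + 2 * (ν * A z) - 2 * W z) ∂vol ≤ (2 * C + 2 * M) * (vol Bx).toReal := by
    have h : ‖∫ z in Bx, max 0 ((V z).2 + 2 * (ν * A z) - 2 * W z) ∂vol‖ ≤ (2 * C + 2 * M) * vol.real Bx :=
      norm_setIntegral_le_of_norm_le_const hBxfin fun z hz => by
        rw [Real.norm_of_nonneg (le_max_left _ _)]; exact hunif z hz
    rw [measureReal_def] at h
    exact (Real.le_norm_self _).trans h
  -- assembling
  rw [htr]
  have h1 := mul_le_mul_of_nonneg_left hI1 (by linarith : (0 : ℝ) ≤ 1 - ε)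
  have h2 := mul_le_mul_of_nonneg_left hI2 (mul_nonneg hε0.le hc0.le)
  have h3 : (1 - ε) * (2 * η + 2 * M * (ε * c / (1 - ε)) * (vol Bx).toReal) =
      (1 - ε) * (2 * η) + 2 * M * ε * (c * (vol Bx).toReal) := by
    have hne : (1 - ε) ≠ 0 := (by linarith : (0 : ℝ) < 1 - ε).ne'
    field_simp
  have h4 : ε * c * ((2 * C + 2 * M) * (vol Bx).toReal) = ε * (2 * C + 2 * M) * (c * (vol Bx).toReal) := by ring
  rw [h3, hc] at h1
  rw [h4, hc] at h2
  nlinarith [h1, h2, mul_nonneg hε0.le hη]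

/-! ### The packaged energy link -/

/-- **(L5c) ENERGY link** of the level pairs of `stub_augCurrentLevelPairs`. See the module docstring. -/
theorem stub_augCurrentLevelEnergyTools {ν : ℝ} {f : UnitAddTorus (Fin 3) → EuclideanSpace ℝ (Fin 3)}
    {μ : Measure (Torus.energySpace (Fin 3))} (hν : 0 < ν) (hf : IsSmooth f) (hμ : IsStationaryStatisticalSolution ν f μ)
    {R : ℝ} (hR : ∀ᵐ u ∂μ, ‖u‖ ≤ R) (hR0 : 0 ≤ R)
    (D : ℕ → ℕ) (g : (n : ℕ) → Fin (D n) → UnitAddTorus (Fin 3) → EuclideanSpace ℝ (Fin 3))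
    (N : ℕ → ℕ) (δ ε c θ : ℕ → ℝ)
    (ρ₁ : (n : ℕ) → EuclideanSpace ℝ (Fin (D n)) → ℝ) (ρ₂ : ℕ → ℝ → ℝ)
    (p₁ : (n : ℕ) → EuclideanSpace ℝ (Fin (D n)) × ℝ → ℝ)
    (J V : (n : ℕ) → EuclideanSpace ℝ (Fin (D n)) × ℝ → EuclideanSpace ℝ (Fin (D n)) × ℝ)
    (m : (n : ℕ) → Measure (EuclideanSpace ℝ (Fin (D n)) × ℝ))
    (hN : Tendsto N atTop atTop) (hδ : ∀ n, 0 < δ n ∧ δ n ≤ 1) (hδ0 : Tendsto δ atTop (𝓝 0))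
    (hε : ∀ n, 0 < ε n ∧ ε n < 1) (hε0 : Tendsto ε atTop (𝓝 0))
    (hθ : ∀ n, θ n = R / (R + δ n))
    (hg : ∀ n j, IsSmooth (g n j))
    (horth : ∀ n i j, ∫ x, ⟪g n i x, g n j x⟫_ℝ = if i = j then 1 else 0)
    (hgH : ∀ n (u : Torus.energySpace (Fin 3)) x, ∑ j, pairing u.1 (g n j) • g n j x =
      fourierTruncate (N n) (u.1 : UnitAddTorus (Fin 3) → EuclideanSpace ℝ (Fin 3)) x)
    (hρ₁ : ∀ n, Continuous (ρ₁ n) ∧ (∀ y, 0 ≤ ρ₁ n y) ∧ (∀ y, δ n ≤ ‖y‖ → ρ₁ n y = 0) ∧ ∫ y, ρ₁ n y = 1)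
    (hρ₂ : ∀ n, Continuous (ρ₂ n) ∧ (∀ s, 0 ≤ ρ₂ n s) ∧ (∀ s, s ∉ Ioo 0 (δ n) → ρ₂ n s = 0) ∧ ∫ s, ρ₂ n s = 1)
    (hp : ∀ n, Continuous (p₁ n)) (hp0 : ∀ n z, 0 ≤ p₁ n z)
    (hpB : ∀ n z, z ∉ closedBall (0 : EuclideanSpace ℝ (Fin (D n))) (R + δ n) ×ˢ Icc 0 (R ^ 2 + δ n) → p₁ n z = 0)
    (hp1 : ∀ n, ∫ z, p₁ n z ∂((volume : Measure (EuclideanSpace ℝ (Fin (D n)))).prod (volume : Measure ℝ)) = 1)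
    (hpZ : ∀ n (z : EuclideanSpace ℝ (Fin (D n)) × ℝ),
      p₁ n z = ∫ u, ρ₁ n (z.1 - WithLp.toLp 2 fun j => pairing u.1 (g n j)) * ρ₂ n (z.2 - ‖u‖ ^ 2) ∂μ)
    (hJc : ∀ n, Continuous (J n))
    (hJi : ∀ n (z : EuclideanSpace ℝ (Fin (D n)) × ℝ), Integrable (fun u : Torus.energySpace (Fin 3) =>
      ρ₁ n (z.1 - WithLp.toLp 2 fun j => pairing u.1 (g n j)) * ρ₂ n (z.2 - ‖u‖ ^ 2) *
        (ν * (eGradNormSq (u.1 : UnitAddTorus (Fin 3) → EuclideanSpace ℝ (Fin 3))).toReal - pairing u.1 f)) μ)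
    (hJe : ∀ n z, (J n z).2 + 2 * ∫ u, ρ₁ n (z.1 - WithLp.toLp 2 fun j => pairing u.1 (g n j)) * ρ₂ n (z.2 - ‖u‖ ^ 2) *
        (ν * (eGradNormSq (u.1 : UnitAddTorus (Fin 3) → EuclideanSpace ℝ (Fin 3))).toReal - pairing u.1 f) ∂μ ≤ 0)
    (hq : ∀ n z, 0 < (1 - ε n) * p₁ n z + ε n * c n)
    (hV : ∀ n z, V n z = ((1 - ε n) / ((1 - ε n) * p₁ n z + ε n * c n)) • J n z)
    (hm : ∀ n, IsProbabilityMeasure (m n))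
    (htr : ∀ n (G : EuclideanSpace ℝ (Fin (D n)) × ℝ → ℝ), Continuous G →
      ∫ z, G z ∂(m n) = (1 - ε n) * ∫ z, G z * p₁ n z ∂((volume : Measure (EuclideanSpace ℝ (Fin (D n)))).prod (volume : Measure ℝ)) +
        ε n * c n * ∫ z in closedBall (0 : EuclideanSpace ℝ (Fin (D n))) (R + δ n) ×ˢ Icc 0 (R ^ 2 + δ n), G z
          ∂((volume : Measure (EuclideanSpace ℝ (Fin (D n)))).prod (volume : Measure ℝ))) :
    (∀ (K : ℕ) (γ : ℝ), 0 < γ → ∀ᶠ n in atTop,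
        ∫ z, max 0 ((V n z).2 +
            2 * (ν * (4 * Real.pi ^ 2 * ∑ k ∈ freqBall K, freqNormSq k *
              ‖mFourierCoeff (EuclideanSpace.complexify ∘ fun x => θ n • ∑ j, z.1 j • g n j x) k‖ ^ 2)) -
            2 * ∫ x, ⟪f x, θ n • ∑ j, z.1 j • g n j x⟫_ℝ) ∂(m n) ≤ γ) := by
  intro K γ hγ
  haveI := hμ.prob
  have hf2 : MemLp f 2 volume := hf.memLp 2
  have hfinae := hμ.ae_eGradNormSq_lt_top
  -- the constants of the bound
  set Cf : ℝ := Real.sqrt (∫ x, ‖f x‖ ^ 2) with hCf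
  set F : ℝ := ∑ k ∈ (freqBall K : Finset (Fin 3 → ℤ)), freqNormSq k with hF
  have hCf0 : 0 ≤ Cf := Real.sqrt_nonneg _
  have hF0 : 0 ≤ F := Finset.sum_nonneg fun k _ => freqNormSq_nonneg k
  have hπ : (0 : ℝ) ≤ 4 * Real.pi ^ 2 := by positivity
  set M : ℝ := ν * (4 * Real.pi ^ 2 * F * R ^ 2) + Cf * R with hM
  have hM0 : 0 ≤ M := add_nonneg (mul_nonneg hν.le (mul_nonneg (mul_nonneg hπ hF0) (sq_nonneg _))) (mul_nonneg hCf0 hR0)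
  set TN : ℕ → ℝ := fun n => (eLpNorm (fourierTruncate (N n) f - f) 2 volume).toReal with hTN
  set η : ℕ → ℝ := fun n => ν * (4 * Real.pi ^ 2 * F * ((2 * R + 1) * δ n)) + (2 * Cf * δ n + R * TN n) with hη
  -- the bound of one level
  have hlevel : ∀ n, ∫ z, max 0 ((V n z).2 +
      2 * (ν * (4 * Real.pi ^ 2 * ∑ k ∈ freqBall K, freqNormSq k *
        ‖mFourierCoeff (EuclideanSpace.complexify ∘ fun x => θ n • ∑ j, z.1 j • g n j x) k‖ ^ 2)) -
      2 * ∫ x, ⟪f x, θ n • ∑ j, z.1 j • g n j x⟫_ℝ) ∂(m n) ≤ 2 * η n + ε n * (2 * (Cf * R) + 4 * M) := by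
    intro n
    obtain ⟨hδp, hδ1⟩ := hδ n
    have hRδ : 0 < R + δ n := by linarith
    have hθ0 : 0 ≤ θ n := by rw [hθ n]; exact div_nonneg hR0 hRδ.le
    have hθ1 : θ n ≤ 1 := by rw [hθ n, div_le_one hRδ]; linarith
    have hθR : (1 - θ n) * R ≤ δ n := by
      have h1 : (1 - θ n) * R = δ n * (R / (R + δ n)) := by rw [hθ n]; field_simp; ring
      have h2 : R / (R + δ n) ≤ 1 := by rw [div_le_one hRδ]; linarith
      rw [h1]
      nlinarith [div_nonneg hR0 hRδ.le]
    have hθm : θ n * (R + δ n) = R := by rw [hθ n]; field_simp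
    have hη0 : 0 ≤ η n := add_nonneg (mul_nonneg hν.le (mul_nonneg (mul_nonneg hπ hF0) (by positivity)))
      (add_nonneg (by positivity) (mul_nonneg hR0 ENNReal.toReal_nonneg))
    -- `c n · vol(Bx n) = 1` from the transport formula
    have hBxfin : ((volume : Measure (EuclideanSpace ℝ (Fin (D n)))).prod (volume : Measure ℝ))
        (closedBall (0 : EuclideanSpace ℝ (Fin (D n))) (R + δ n) ×ˢ Icc 0 (R ^ 2 + δ n)) < ∞ :=
      ((isCompact_closedBall _ _).prod isCompact_Icc).measure_lt_top
    have hc1 := ((stub_augCurrentLevelTransportTools μ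
      ((volume : Measure (EuclideanSpace ℝ (Fin (D n)))).prod (volume : Measure ℝ))
      (Z := fun _ => (0 : EuclideanSpace ℝ (Fin (D n)) × ℝ)) measurable_const (ρ := fun _ => (0 : ℝ))
      continuous_const (fun _ => le_rfl) (integrable_zero _ _ _) (G := fun _ => (0 : ℝ)) continuous_const (B := 0)
      (fun _ => by rw [abs_zero])).2.2.2 (m n) (ε n) (c n) (p₁ n) _ (hm n) (hε n).1 hBxfin (hp1 n) (htr n)).1
    -- continuity of the level observable
    have hVc : Continuous (V n) := by
      rw [show V n = fun z => ((1 - ε n) / ((1 - ε n) * p₁ n z + ε n * c n)) • J n z from funext (hV n)]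
      exact (continuous_const.div ((continuous_const.mul (hp n)).add continuous_const) fun z => (hq n z).ne').smul (hJc n)
    have hAc : Continuous fun z : EuclideanSpace ℝ (Fin (D n)) × ℝ => 4 * Real.pi ^ 2 * ∑ k ∈ freqBall K, freqNormSq k *
        ‖mFourierCoeff (EuclideanSpace.complexify ∘ fun x => θ n • ∑ j, z.1 j • g n j x) k‖ ^ 2 :=
      continuous_const.mul (continuous_finsetSum _ fun k _ => continuous_const.mul
        (((continuous_mFourierCoeff_synth (hg n) (θ n) k).comp continuous_fst).norm.pow 2))
    have hWc : Continuous fun z : EuclideanSpace ℝ (Fin (D n)) × ℝ => ∫ x, ⟪f x, θ n • ∑ j, z.1 j • g n j x⟫_ℝ := by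
      rw [show (fun z : EuclideanSpace ℝ (Fin (D n)) × ℝ => ∫ x, ⟪f x, θ n • ∑ j, z.1 j • g n j x⟫_ℝ) =
        fun z => θ n * ∑ j, z.1 j * ∫ x, ⟪f x, g n j x⟫_ℝ from funext fun z => integral_inner_synth (hg n) hf.integrable (θ n) z.1]
      exact continuous_const.mul (continuous_finsetSum _ fun j _ =>
        ((PiLp.continuous_apply 2 _ j).comp continuous_fst).mul continuous_const)
    have hGc : Continuous fun z : EuclideanSpace ℝ (Fin (D n)) × ℝ => max 0 ((V n z).2 +
        2 * (ν * (4 * Real.pi ^ 2 * ∑ k ∈ freqBall K, freqNormSq k *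
          ‖mFourierCoeff (EuclideanSpace.complexify ∘ fun x => θ n • ∑ j, z.1 j • g n j x) k‖ ^ 2)) -
        2 * ∫ x, ⟪f x, θ n • ∑ j, z.1 j • g n j x⟫_ℝ) :=
      continuous_const.max (((continuous_snd.comp hVc).add (continuous_const.mul (continuous_const.mul hAc))).sub
        (continuous_const.mul hWc))
    -- the abstract assembly
    refine level_assembly_le (hε n) hη0 hM0 (mul_nonneg hCf0 hR0) (hp0 n) (hpB n) (hp1 n) (hJe n)
      (fun z => ?_) (fun z => ?_) (fun z hz => ?_) (hq n) (hV n) hc1 (htr n _ hGc)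
    · rw [hpZ n z]
      exact (stub_augCurrentLevelEnergyGapTools hν hf2 hR hfinae (hg n) (horth n) (hgH n) hθ0 hθ1 hθR hδ1 (hρ₁ n) (hρ₂ n)
        (freqBall K) z (hJi n z)).2 _ (hJe n z)
    · rw [hpZ n z]
      exact (stub_augCurrentLevelEnergyGapTools hν hf2 hR hfinae (hg n) (horth n) (hgH n) hθ0 hθ1 hθR hδ1 (hρ₁ n) (hρ₂ n)
        (freqBall K) z (hJi n z)).1
    · have hz1 : ‖z.1‖ ≤ R + δ n := mem_closedBall_zero_iff.1 (Set.mem_prod.1 hz).1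
      exact level_sup_le hν.le hf2 (hg n) (horth n) hθ0 z.1 ((mul_le_mul_of_nonneg_left hz1 hθ0).trans hθm.le) (freqBall K)
  -- the bound tends to zero
  have hT : Tendsto TN atTop (𝓝 0) := by
    have h := (ENNReal.tendsto_toReal ENNReal.zero_ne_top).comp ((tendsto_eLpNorm_fourierTruncate_sub hf2).comp hN)
    rwa [ENNReal.toReal_zero] at h
  have hηt : Tendsto η atTop (𝓝 0) := by
    have h := (((hδ0.const_mul (2 * R + 1)).const_mul (4 * Real.pi ^ 2 * F)).const_mul ν).add
      ((hδ0.const_mul (2 * Cf)).add (hT.const_mul R))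
    simpa using h
  have hb : Tendsto (fun n => 2 * η n + ε n * (2 * (Cf * R) + 4 * M)) atTop (𝓝 0) := by
    simpa using (hηt.const_mul 2).add (hε0.mul_const (2 * (Cf * R) + 4 * M))
  filter_upwards [hb.eventually (gt_mem_nhds hγ)] with n hn
  exact (hlevel n).trans hn.le

end Summit.AnomalousDissipation.AnomalousDissipation.Theorems.EnsembleRealization
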